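import Literature.NumberTheory.EllipticCurves.BurungaleSkinnerTianWan2024.OrdinaryTwoVariableDivisibilitySemistableOPEN
import Literature.NumberTheory.EllipticCurves.BurungaleSkinnerTianWan2024.OrdinaryTwoVariableMainStatementOfDivisibilityProofs
import Literature.NumberTheory.EllipticCurves.YanZhu2026.HidaRankinLFunctionExistence
import HarnessLib

/-!
# BSTW arXiv:2409.01350v2 Thm. 10.10 (b), case `· = ∅`, REPLAYED IN THE KERNEL from the Thm. 10.5
# (`∘ = ∅`) binder: statements 9.10-`∅` and 9.12-`∅` for a semistable curve under (def)/(indef) from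
# the Eisenstein-congruence DIVISIBILITY and refereed print — the by-name layer (proofs only)

A *proofs* file (theorems only: no definition, no named fact, no instance, no `sorry`) written by the
typer seat `bsd-littype-01` (gen 8) of the cross-ladder literature-typing layer (D-0088(4); cell
`run/shared/lean/pub/bsd-littype/`). It composes the gen-8 binder
`thm105_ordinary_twoVariableDivisibility_OPEN` (`OrdinaryTwoVariableDivisibilitySemistableOPEN.lean`:
Thm. 10.5, "An Eisenstein congruence divisibility", case `∘ = ∅`) with the pointwise layer
`OrdinaryTwoVariableMainStatementOfDivisibilityProofs.lean` (every OTHER step of BSTW's §10.4 proof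
template as a kernel theorem over refereed print) and states the CONCLUSIONS of the gen-7 binders
`thm1010b_standardMainStatement_twoVariable_OPEN` / `thm1010b_greenbergMainStatement_twoVariable_OPEN`
(`OrdinaryTwoVariableMainStatementSemistableOPEN.lean`) verbatim, under their hypothesis block
`Thm1010bHypotheses W p N K`, on the cyclotomic/anticyclotomic coordinates. HONEST FRAMING: typed ≠
proved ≠ endorsed; nothing here proves BSD or a main "conj."; every theorem is CONDITIONAL on the named
binders / facts it lists. What the kernel certifies is BSTW's sentence "One may proceed just as in the
proof of Theorem 10.8" (Thm. 10.10, proof, p. 89, tex l.7528), case `· = ∅`, for `g = f_E`.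

## The DAG (what feeds what)

  9.10-`∅` for `E/L` (torsion ∧ `Char(X) ⊂ (𝓛)` ∧ `(𝓛) ⊂ Char(X)`, every Hida frame `F`)
    ⟸ Thm. 10.5-`∅` binder (`IdealLeSpan`; PRE — the ONE preprint-specific input)
     + Thm. 10.10 (a) for `g` and `g ⊗ χ_L` (O1/O2 binders — `…_of_thm1010_OPEN`; OR [SU14] Thm. 3.6.9
       `hSU` + Greenberg–Vatsal `h5`/`h3` + modularity `hmod` + Ribet–Diamond `hLL` through the ARM-P
       reader's `…_of_skinnerUrban` theorems — `…_of_skinnerUrban`)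
     + Yan–Zhu 2026 Cor. 2.9 (`h29`), Lemma 5.3 (`h53`), Prop. 3.7 (`h37`) (REFEREED named facts)
     + modularity as `nonempty_modularParametrizationData` (`hmodpar`: parametrisation of the minimal
       model of `E^L`, for its newform and rational period ratio)
     + tree THEOREMS: Rohrlich, Edixhoven's rational period ratio, Skinner–Urban Lemma 3.1.7, the
       discharge of every side condition from `Thm1010bHypotheses` (pointwise layer §0–§3);
  9.12-`∅` for `E/L` (torsion of `X_Gr` ∧ `char(X_Gr)𝒪_{ℂ_p}⟦T₁,T₂⟧ = (G)`, every Katz/Greenberg frame)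
    ⟸ 9.10-`∅` (both inclusions, for one congruence-integral Hida frame: Yan–Zhu Thm. 3.3 `h33`)
     + Yan–Zhu Thm. 4.7 at `S = {1}` (`h47`) + BCS25 Thm. 4.1.3 (`h413`) (REFEREED; pointwise layer §4),
    under `D_L ≠ −3`.

## Hypotheses versus the sibling binders (numbers, not adjectives)

`thm1010b_standardMainStatement_twoVariable_OPEN` quantifies over ANY pair `(κ₁, κ₂)` of
`ℤ_p`-extensions of `K` with adapted generators; the replay delivers its conclusion for THE
cyclotomic/anticyclotomic pair with `γ₁|_{ℚ_∞}` the normalised generator of `Gal(ℚ_∞/ℚ)`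
(`κ.IsTopGenerator (absGaloisRestrict ℚ K γ₁)`, `IsCyclotomicVariable p (absGaloisRestrict ℚ K γ₁)` for
the cyclotomic `κ` of `ℚ` — the coordinates in which Yan–Zhu Lemma 5.3 / Prop. 3.7 are printed): WEAKER by
exactly this coordinate normalisation (the torsion clause holds for every pair).
`thm1010b_greenbergMainStatement_twoVariable_OPEN` already fixes the cyclotomic/anticyclotomic pair; the
replay is WEAKER than it by exactly `D_L ≠ −3` (the field `discr_ne` of Yan–Zhu's `GreenbergSetting`,
under which Thm. 4.7 / 4.1.3 are typed) and the same `γ₁`-normalisation. Never stronger than print.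
NOT replayed: the quadratic-twist clauses of 10.10 (b) (the `K`-rational twist-invariance of (irr_L) is
not in the tree; cell census GAP, OPEN-QUESTIONS-01 §K) and the one-variable cases (gen-7 sibling
`OrdinaryOneVariableMainStatementSemistableOPEN.lean`; descent, Prop. 10.7-type control).

CONSEQUENCE FOR THE PRICING DESKS (no pricing here — referee A's / ARM P's word): on the (def)/(indef)
locus the preprint content of Thm. 10.10 (b), case `· = ∅`, is EXACTLY Thm. 10.5 (`∘ = ∅`) — the
two-variable Eisenstein-congruence divisibility (Thm. 9.24 (a) from [W1]/[CLW] via BSTW's explicit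
reciprocity laws, the `μ = 0` inputs [PW]/[Va] under (def) and [Bu] under (indef), and the undisplayed
interpolation comparison tex l.7427–7428); everything else in its printed proof is refereed print in the
tree, composed here. Net: 0 definitions, 0 facts.

## References
* [BurungaleSkinnerTianWan2024] arXiv:2409.01350v2: Thm. 10.10 (b) (p. 89; tex l.7519–7530) and its
  proof pointer (l.7528); proof of Thm. 10.8 (pp. 88–89; l.7496–7514); Thm. 10.5 (pp. 87–88;
  l.7387–7437); statements 9.10 / 9.12 (p. 81).
* [YanZhu2024MainConjNonCM] J. Algebra 693 (2026) = arXiv:2412.20078v4: Cor. 2.9, Thm. 3.3, Prop. 3.7,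
  Thm. 4.7, Lemma 5.3. [BurungaleCastellaSkinner2025] IMRN 2025, Thm. 4.1.3.
* [SkinnerUrban2014] Invent. Math. 195 (2014), Lemma 3.1.7, Thm. 3.6.9. [RohrlichInventiones1984].
  [GreenbergVatsal2000] §3 Rem. 3.4. [Ribet1990] Thm. 1.1. [Diamond1995RefinedSerre]. [BCDTJAMS2001].
-/

noncomputable section

open scoped Classical

open PowerSeries NumberField IsDedekindDomain Field CongruenceSubgroup
  Literature.NumberTheory.GaloisRepresentations Literature.NumberTheory.EllipticCurves
  Literature.NumberTheory.EllipticCurves.ModularForms Literature.NumberTheory.EllipticCurves.Rank1Residual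

namespace Literature.NumberTheory.EllipticCurves.BurungaleSkinnerTianWan2024

open IwasawaAlgebra₂ YanZhu2026 BurungaleCastellaSkinner2025 SkinnerUrban2014
  Literature.NumberTheory.Automorphic

variable {p : ℕ} [Fact p.Prime]

/-! ## Statement 9.10, case `∅` (Thm. 10.10 (b)), from the Thm. 10.5 binder -/

/-- **BSTW Thm. 10.10 (b), statement 9.10 in the two-variable case `· = ∅`, for `g = f_E` — the
sibling binder's conclusion (torsion ∧ for every Hida frame `F`: `Char(X) ⊂ (𝓛)` ∧ `(𝓛) ⊂ Char(X)`)
PROVED from the Thm. 10.5 (`∘ = ∅`) binder `thm105_ordinary_twoVariableDivisibility_OPEN` (`h105`), the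
two Thm. 10.10 (a) binders (`hO1`, `hO2`), the refereed Yan–Zhu Cor. 2.9 / Lemma 5.3 / Prop. 3.7
(`h29`, `h53`, `h37`) and modularity (`hmodpar`)** — under `Thm1010bHypotheses W p N K`, on the
cyclotomic/anticyclotomic coordinates with `γ₁|_{ℚ_∞}` the normalised cyclotomic generator (module
docstring, "Hypotheses versus the sibling binders": WEAKER than the binder by this normalisation only).
This is the kernel form of "One may proceed just as in the proof of Theorem 10.8" (p. 89). CONDITIONAL
on the named binders/facts; closes nothing by itself. [claim: BurungaleSkinnerTianWan2024, status: under-review]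
[cite: BurungaleSkinnerTianWan2024, Thm. 10.10 (b) (p. 89; tex l.7523–7528) with statement 9.10 (p. 81) and the proof of Thm. 10.8 (pp. 88–89, l.7496–7510); Thm. 10.5 (pp. 87–88)]
[cite: YanZhu2024MainConjNonCM, Cor. 2.9, Lemma 5.3, Prop. 3.7 (arXiv:2412.20078v4 TeX l.628–633, l.1086–1093, l.821–829)]
[cite: SkinnerUrban2014, Lemma 3.1.7 (p. 20)] -/
theorem standardMainStatement_twoVariable_of_thm105_OPEN_of_thm1010_OPEN
    (h105 : thm105_ordinary_twoVariableDivisibility_OPEN)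
    (hO1 : thm1010a_mainStatement_semistable_ordinary_OPEN) (hO2 : thm1010_twist_mainStatement_OPEN)
    (h29 : cor29_XOrd₂_isTorsion) (h53 : lemma53_charIdeal_mul_charIdeal_le_toPlus_charIdeal)
    (h37 : prop37_cycRestrict_perrinRiou_eq_padicLFunction_mul)
    (hmodpar : nonempty_modularParametrizationData)
    (ι : integralClosure ℚ ℂ →+* ℂ_[p]) (W : WeierstrassCurve ℚ) [W.IsElliptic] [W.IsGloballyMinimal]
    (K : Type) [Field K] [NumberField K] (κ₁ κ₂ : ZpExtension K p) (γ₁ γ₂ : absoluteGaloisGroup K)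
    [Fact (ZpExtension.IsTopGeneratorPair κ₁ κ₂ γ₁ γ₂)] {N : ℕ} [NeZero N]
    (π : ModularParametrizationData W N) (hyp : Thm1010bHypotheses W p N K)
    (hκ₁ : κ₁.IsCyclotomic) (hκ₂ : κ₂.IsAnticyclotomic) (κ : ZpExtension ℚ p) (hκ : κ.IsCyclotomic)
    (hγ : κ.IsTopGenerator (absGaloisRestrict ℚ K γ₁))
    (hγ' : IsCyclotomicVariable p (absGaloisRestrict ℚ K γ₁)) :
    Module.IsTorsion (IwasawaAlgebra₂ p) ((W.baseChange K).XOrd₂ p κ₁ κ₂ γ₁ γ₂) ∧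
      ∀ F : CycAntiSeries p, IsHidaRankinLFunction ι W κ₁ κ₂ π.f F →
        IdealLeSpan (WeierstrassCurve.XOrd₂.charIdeal (W.baseChange K) p κ₁ κ₂ γ₁ γ₂)
            (perrinRiouLFunction W π F) ∧
          SpanLeIdeal (perrinRiouLFunction W π F)
            (WeierstrassCurve.XOrd₂.charIdeal (W.baseChange K) p κ₁ κ₂ γ₁ γ₂) :=
  ⟨xOrd₂_isTorsion_of_cor29 h29 W κ₁ κ₂ γ₁ γ₂ hyp, fun F hF ↦
    ⟨h105 ι W K κ₁ κ₂ γ₁ γ₂ π hyp F hF,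
      spanLeIdeal_perrinRiou_of_idealLeSpan_of_thm1010_OPEN hO1 hO2 h53 h37 hmodpar ι W K κ₁ κ₂ γ₁ γ₂ π
        hyp hκ₁ hκ₂ κ hκ hγ hγ' hF (h105 ι W K κ₁ κ₂ γ₁ γ₂ π hyp F hF)⟩⟩

/-- **The same with the Thm. 10.10 (a) inputs fed by REFEREED print** ([SU14] Thm. 3.6.9 `hSU`,
Greenberg–Vatsal `h5`/`h3`, modularity `hmod`, Ribet–Diamond `hLL`): statement 9.10 (`∅`) on the locus of
Thm. 10.10 (b) is a kernel consequence of the Thm. 10.5 (`∘ = ∅`) binder and refereed named facts (the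
[SU14] input carries the cell's `p = 3` flag `SU14-12.3.6-mu@nonsplit@3`). CONDITIONAL; closes nothing by
itself. [claim: BurungaleSkinnerTianWan2024, status: under-review]
[cite: BurungaleSkinnerTianWan2024, Thm. 10.10 (b) and Rem. 10.11 (p. 89; tex l.7519–7533); Thm. 10.5 (pp. 87–88)]
[cite: SkinnerUrban2014, Thm. 3.6.9 and p. 45; Lemma 3.1.7 (p. 20)] -/
theorem standardMainStatement_twoVariable_of_thm105_OPEN_of_skinnerUrban
    (h105 : thm105_ordinary_twoVariableDivisibility_OPEN)
    (hSU : ∀ (W : WeierstrassCurve ℚ) [W.IsElliptic] [W.IsGloballyMinimal] (p : ℕ) [Fact p.Prime]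
      (κ : ZpExtension ℚ p) (γ : Field.absoluteGaloisGroup ℚ) (N : ℕ) [NeZero N]
      (f : CuspForm (Gamma0 N) 2),
      skinner_urban_main_conjecture W p (κ := κ) (γ := γ) (f := f))
    (h5 : realPeriodRat_eq_unit_mul_plusPeriod) (h3 : realPeriodRat_eq_unit_mul_plusPeriod_three)
    (hmod : exists_isNewformOf) (hLL : diamond1995_refinedSerre)
    (h29 : cor29_XOrd₂_isTorsion) (h53 : lemma53_charIdeal_mul_charIdeal_le_toPlus_charIdeal)
    (h37 : prop37_cycRestrict_perrinRiou_eq_padicLFunction_mul)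
    (hmodpar : nonempty_modularParametrizationData)
    (ι : integralClosure ℚ ℂ →+* ℂ_[p]) (W : WeierstrassCurve ℚ) [W.IsElliptic] [W.IsGloballyMinimal]
    (K : Type) [Field K] [NumberField K] (κ₁ κ₂ : ZpExtension K p) (γ₁ γ₂ : absoluteGaloisGroup K)
    [Fact (ZpExtension.IsTopGeneratorPair κ₁ κ₂ γ₁ γ₂)] {N : ℕ} [NeZero N]
    (π : ModularParametrizationData W N) (hyp : Thm1010bHypotheses W p N K)
    (hκ₁ : κ₁.IsCyclotomic) (hκ₂ : κ₂.IsAnticyclotomic) (κ : ZpExtension ℚ p) (hκ : κ.IsCyclotomic)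
    (hγ : κ.IsTopGenerator (absGaloisRestrict ℚ K γ₁))
    (hγ' : IsCyclotomicVariable p (absGaloisRestrict ℚ K γ₁)) :
    Module.IsTorsion (IwasawaAlgebra₂ p) ((W.baseChange K).XOrd₂ p κ₁ κ₂ γ₁ γ₂) ∧
      ∀ F : CycAntiSeries p, IsHidaRankinLFunction ι W κ₁ κ₂ π.f F →
        IdealLeSpan (WeierstrassCurve.XOrd₂.charIdeal (W.baseChange K) p κ₁ κ₂ γ₁ γ₂)
            (perrinRiouLFunction W π F) ∧
          SpanLeIdeal (perrinRiouLFunction W π F)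
            (WeierstrassCurve.XOrd₂.charIdeal (W.baseChange K) p κ₁ κ₂ γ₁ γ₂) :=
  standardMainStatement_twoVariable_of_thm105_OPEN_of_thm1010_OPEN h105
    (thm1010a_mainStatement_semistable_ordinary_OPEN_of_skinnerUrban hSU h5 h3 hmod hLL)
    (thm1010_twist_mainStatement_OPEN_of_skinnerUrban hSU h5 h3 hmod hLL) h29 h53 h37 hmodpar ι W K κ₁ κ₂
    γ₁ γ₂ π hyp hκ₁ hκ₂ κ hκ hγ hγ'

/-! ## Statement 9.12, case `∅` (Thm. 10.10 (b), "In particular"), from the Thm. 10.5 binder -/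

/-- **BSTW Thm. 10.10 (b), statement 9.12 in the two-variable case `· = ∅` ("In particular Conj[.]
Greenberg is true for `· = ∅`"), for `g = f_E` — the sibling Greenberg binder's conclusion (torsion of
`X_Gr` ∧ `char(X_Gr)𝒪_{ℂ_p}⟦T₁,T₂⟧ = (G)` for every Katz/Greenberg frame and structure-compatible `J`)
PROVED from the Thm. 10.5 (`∘ = ∅`) binder, the two Thm. 10.10 (a) binders, and REFEREED print**
(Yan–Zhu Cor. 2.9 / Thm. 3.3 / Lemma 5.3 / Prop. 3.7 / Thm. 4.7, BCS25 Thm. 4.1.3, modularity) — under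
`Thm1010bHypotheses W p N K` with `D_L ≠ −3`, the `ι`-prime data, THE cyclotomic/anticyclotomic pair
with `γ₁|_{ℚ_∞}` normalised, for the newform `f` of `W` at level `N` (= `π.f` of any parametrisation, by
`IsNewformOf.unique`). WEAKER than the binder `thm1010b_greenbergMainStatement_twoVariable_OPEN` by
exactly `D_L ≠ −3` and the `γ₁`-normalisation. CONDITIONAL; closes nothing by itself.
[claim: BurungaleSkinnerTianWan2024, status: under-review]
[cite: BurungaleSkinnerTianWan2024, Thm. 10.10 (b) (p. 89) with statement 9.12 (p. 81; l.6935–6944), proof of Thm. 10.8 last sentence (l.7513), Thm. 10.5 (pp. 87–88)]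
[cite: YanZhu2024MainConjNonCM, Thm. 4.7, Thm. 3.3, Cor. 2.9 (arXiv:2412.20078v4 TeX l.1022–1034, l.738–752, l.628–633)]
[cite: BurungaleCastellaSkinner2025, Thm. 4.1.3 (§4.1)] -/
theorem greenbergMainStatement_twoVariable_of_thm105_OPEN_of_thm1010_OPEN
    (h105 : thm105_ordinary_twoVariableDivisibility_OPEN)
    (hO1 : thm1010a_mainStatement_semistable_ordinary_OPEN) (hO2 : thm1010_twist_mainStatement_OPEN)
    (h29 : cor29_XOrd₂_isTorsion) (h33 : thm33_exists_isHidaRankinLFunction)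
    (h53 : lemma53_charIdeal_mul_charIdeal_le_toPlus_charIdeal)
    (h37 : prop37_cycRestrict_perrinRiou_eq_padicLFunction_mul)
    (h47 : thm47_ord_localised_iff_greenbergAnyRoot_localised)
    (h413 : thm413_ord_torsion_dvd_iff_greenberg_torsion_dvd)
    (hmodpar : nonempty_modularParametrizationData)
    (ι₁ : integralClosure ℚ ℂ →+* ℂ_[p]) (ι : PadicAlgCl p ≃+* ℂ) (W : WeierstrassCurve ℚ) [W.IsElliptic]
    [W.IsGloballyMinimal] (K : Type) [Field K] [NumberField K] (v vbar : HeightOneSpectrum (𝓞 K))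
    (κ₁ κ₂ : ZpExtension K p) (γ₁ γ₂ : absoluteGaloisGroup K)
    [Fact (ZpExtension.IsTopGeneratorPair κ₁ κ₂ γ₁ γ₂)] {N : ℕ} [NeZero N] {f : CuspForm (Gamma0 N) 2}
    (hf : IsNewformOf W f) [NeZero (NumberField.discr K).natAbs] (hyp : Thm1010bHypotheses W p N K)
    (hv : ((p : ℕ) : 𝓞 K) ∈ v.asIdeal) (hvbar : ((p : ℕ) : 𝓞 K) ∈ vbar.asIdeal) (hne : vbar ≠ v)
    (hcompat : ∀ (w : InfinitePlace K) (k : 𝓞 K), k ∈ v.asIdeal ↔ ‖ι.symm (w.embedding (k : K))‖ < 1)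
    (hκ₁ : κ₁.IsCyclotomic) (hκ₂ : κ₂.IsAnticyclotomic) (hD3 : NumberField.discr K ≠ -3)
    (hι : ∀ z : integralClosure ℚ ℂ, ι₁ z = ((ι.symm (z : ℂ) : PadicAlgCl p) : ℂ_[p]))
    (κ : ZpExtension ℚ p) (hκ : κ.IsCyclotomic) (hγ : κ.IsTopGenerator (absGaloisRestrict ℚ K γ₁))
    (hγ' : IsCyclotomicVariable p (absGaloisRestrict ℚ K γ₁))
    {Ω δ : ℂ} {Ωp : (unrIntegers p)ˣ} {LK G : PowerSeries (PowerSeries (PadicComplexInt p))}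
    (hLK : IsKatzMeasure₂ ι v vbar ∅ κ₁ κ₂ γ₁⁻¹ γ₂⁻¹ 1 Ω δ ((Ωp : unrIntegers p) : ℂ_[p]) LK)
    (hG : IsGreenbergLFunctionAnyRoot₂ ι v vbar κ₁ κ₂ γ₁⁻¹ γ₂⁻¹ f (NumberField.discr K).natAbs
      (NumberField.classNumber K) LK G)
    (J : ℤ_[p] →+* PadicComplexInt p)
    (hJ : ∀ x : ℤ_[p], ((J x : PadicComplexInt p) : ℂ_[p]) = ((x : ℚ_[p]) : ℂ_[p])) :
    Module.IsTorsion (IwasawaAlgebra₂ p) ((W.baseChange K).XGr₂ p κ₁ κ₂ vbar γ₁ γ₂) ∧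
      (WeierstrassCurve.XGr₂.charIdeal (W.baseChange K) p κ₁ κ₂ vbar γ₁ γ₂).map (toUnr₂ p J) =
        Ideal.span {G} := by
  -- a modular parametrisation at level `N = N_E`, whose newform is `f`
  obtain rfl : N = W.conductorNorm ℤ := by exact_mod_cast hyp.level
  obtain ⟨π⟩ := hmodpar W
  obtain rfl : f = π.f := hf.unique π.isNewformOf
  -- a congruence-integral Hida frame (Yan–Zhu Thm. 3.3)
  obtain ⟨F, hF, hcF⟩ := h33 ι₁ W K κ₁ κ₂ γ₁ γ₂ π.isNewformOf hyp.level hyp.three_le hyp.goodOrd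
    hyp.isImaginaryQuadratic hyp.split hyp.coprime_level
  -- both inclusions of 9.10 (`∅`) for this frame
  have hle := h105 ι₁ W K κ₁ κ₂ γ₁ γ₂ π hyp F hF
  have hge := spanLeIdeal_perrinRiou_of_idealLeSpan_of_thm1010_OPEN hO1 hO2 h53 h37 hmodpar ι₁ W K κ₁
    κ₂ γ₁ γ₂ π hyp hκ₁ hκ₂ κ hκ hγ hγ' hF hle
  exact greenbergMainStatement_twoVariable_of_idealLeSpan_of_spanLeIdeal h47 h413 h29 ι₁ ι W K v vbar
    κ₁ κ₂ γ₁ γ₂ π hyp hv hvbar hne hcompat hκ₁ hκ₂ hD3 hι hF hcF hle hge hLK hG J hJ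

/-- **The same with the Thm. 10.10 (a) inputs fed by REFEREED print** ([SU14] `hSU`, `h5`, `h3`, `hmod`,
`hLL`): statement 9.12 (`∅`) on the locus of Thm. 10.10 (b) with `D_L ≠ −3` is a kernel consequence of
the Thm. 10.5 (`∘ = ∅`) binder and refereed named facts. CONDITIONAL; closes nothing by itself.
[claim: BurungaleSkinnerTianWan2024, status: under-review]
[cite: BurungaleSkinnerTianWan2024, Thm. 10.10 (b) and Rem. 10.11 (p. 89); Thm. 10.5 (pp. 87–88)]
[cite: YanZhu2024MainConjNonCM, Thm. 4.7 (arXiv:2412.20078v4 TeX l.1022–1034)] [cite: BurungaleCastellaSkinner2025, Thm. 4.1.3 (§4.1)] -/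
theorem greenbergMainStatement_twoVariable_of_thm105_OPEN_of_skinnerUrban
    (h105 : thm105_ordinary_twoVariableDivisibility_OPEN)
    (hSU : ∀ (W : WeierstrassCurve ℚ) [W.IsElliptic] [W.IsGloballyMinimal] (p : ℕ) [Fact p.Prime]
      (κ : ZpExtension ℚ p) (γ : Field.absoluteGaloisGroup ℚ) (N : ℕ) [NeZero N]
      (f : CuspForm (Gamma0 N) 2),
      skinner_urban_main_conjecture W p (κ := κ) (γ := γ) (f := f))
    (h5 : realPeriodRat_eq_unit_mul_plusPeriod) (h3 : realPeriodRat_eq_unit_mul_plusPeriod_three)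
    (hmod : exists_isNewformOf) (hLL : diamond1995_refinedSerre)
    (h29 : cor29_XOrd₂_isTorsion) (h33 : thm33_exists_isHidaRankinLFunction)
    (h53 : lemma53_charIdeal_mul_charIdeal_le_toPlus_charIdeal)
    (h37 : prop37_cycRestrict_perrinRiou_eq_padicLFunction_mul)
    (h47 : thm47_ord_localised_iff_greenbergAnyRoot_localised)
    (h413 : thm413_ord_torsion_dvd_iff_greenberg_torsion_dvd)
    (hmodpar : nonempty_modularParametrizationData)
    (ι₁ : integralClosure ℚ ℂ →+* ℂ_[p]) (ι : PadicAlgCl p ≃+* ℂ) (W : WeierstrassCurve ℚ) [W.IsElliptic]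
    [W.IsGloballyMinimal] (K : Type) [Field K] [NumberField K] (v vbar : HeightOneSpectrum (𝓞 K))
    (κ₁ κ₂ : ZpExtension K p) (γ₁ γ₂ : absoluteGaloisGroup K)
    [Fact (ZpExtension.IsTopGeneratorPair κ₁ κ₂ γ₁ γ₂)] {N : ℕ} [NeZero N] {f : CuspForm (Gamma0 N) 2}
    (hf : IsNewformOf W f) [NeZero (NumberField.discr K).natAbs] (hyp : Thm1010bHypotheses W p N K)
    (hv : ((p : ℕ) : 𝓞 K) ∈ v.asIdeal) (hvbar : ((p : ℕ) : 𝓞 K) ∈ vbar.asIdeal) (hne : vbar ≠ v)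
    (hcompat : ∀ (w : InfinitePlace K) (k : 𝓞 K), k ∈ v.asIdeal ↔ ‖ι.symm (w.embedding (k : K))‖ < 1)
    (hκ₁ : κ₁.IsCyclotomic) (hκ₂ : κ₂.IsAnticyclotomic) (hD3 : NumberField.discr K ≠ -3)
    (hι : ∀ z : integralClosure ℚ ℂ, ι₁ z = ((ι.symm (z : ℂ) : PadicAlgCl p) : ℂ_[p]))
    (κ : ZpExtension ℚ p) (hκ : κ.IsCyclotomic) (hγ : κ.IsTopGenerator (absGaloisRestrict ℚ K γ₁))
    (hγ' : IsCyclotomicVariable p (absGaloisRestrict ℚ K γ₁))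
    {Ω δ : ℂ} {Ωp : (unrIntegers p)ˣ} {LK G : PowerSeries (PowerSeries (PadicComplexInt p))}
    (hLK : IsKatzMeasure₂ ι v vbar ∅ κ₁ κ₂ γ₁⁻¹ γ₂⁻¹ 1 Ω δ ((Ωp : unrIntegers p) : ℂ_[p]) LK)
    (hG : IsGreenbergLFunctionAnyRoot₂ ι v vbar κ₁ κ₂ γ₁⁻¹ γ₂⁻¹ f (NumberField.discr K).natAbs
      (NumberField.classNumber K) LK G)
    (J : ℤ_[p] →+* PadicComplexInt p)
    (hJ : ∀ x : ℤ_[p], ((J x : PadicComplexInt p) : ℂ_[p]) = ((x : ℚ_[p]) : ℂ_[p])) :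
    Module.IsTorsion (IwasawaAlgebra₂ p) ((W.baseChange K).XGr₂ p κ₁ κ₂ vbar γ₁ γ₂) ∧
      (WeierstrassCurve.XGr₂.charIdeal (W.baseChange K) p κ₁ κ₂ vbar γ₁ γ₂).map (toUnr₂ p J) =
        Ideal.span {G} :=
  greenbergMainStatement_twoVariable_of_thm105_OPEN_of_thm1010_OPEN h105
    (thm1010a_mainStatement_semistable_ordinary_OPEN_of_skinnerUrban hSU h5 h3 hmod hLL)
    (thm1010_twist_mainStatement_OPEN_of_skinnerUrban hSU h5 h3 hmod hLL) h29 h33 h53 h37 h47 h413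
    hmodpar ι₁ ι W K v vbar κ₁ κ₂ γ₁ γ₂ hf hyp hv hvbar hne hcompat hκ₁ hκ₂ hD3 hι κ hκ hγ hγ' hLK hG J hJ

end Literature.NumberTheory.EllipticCurves.BurungaleSkinnerTianWan2024

end
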